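import Summits.BirchSwinnertonDyer.BirchSwinnertonDyer.Theorems.ByReductionTypeAtTwoOrdKatoHalfAtTwoIsoQTermTranspositionValues
import Summits.BirchSwinnertonDyer.Rank1Residual.GaloisImage.UnramifiedClassesIsotropic
import HarnessLib

/-!
# Crux `OrdKatoHalfAtTwoIso` (stmt-BirchSwinnertonDyer-19573), line `steinberg-fibre-at-two` (v5): helper W4b,
# file 2/3 — the coefficient FAMILY of the local cup product at a TRANSPOSITION prime (`p = 2`) is `u(T)·⟨N·,·⟩`

HONEST FRAMING (cell bsd-2adic): BSD is not proved; the crux is NOT proved; no registered stub is proved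
here; nothing is booked.  KERNEL HELPER (`--supports … --as helper`) toward interior step M3 (K4-local, the
`q`-term identity at a transposition prime) of the registered stub `stub_HK_kolyvaginRankOneTwo` (Ω road;
credit: scrit STUB-PLAN F4/K4, sidea-stub_port-2 card #9).  Replaces, at `p = 2`, the odd core's `E`-split
`…X9LocalQTermFamily` (exact depth, TRANSVERSE `φ`, rank-one naturality) by the TRANSPOSITION twin: `Fr`
acts slotwise as a transposition `t` (`J ≤ 2^m`, `res Fr ∈ Γ_m`), `N := t − 1`, `ker N = im N = {0, P₀}`,
and the identity holds for EVERY local cocycle `φ` (pairing with an unramified class only sees `φ|_{I_q}`).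
TOOL theorem only (no definition, no named fact, no `sorry`); nothing is asserted about any curve.

* `exists_inv_cupProduct_eq_sum_convCoeff_transposition`: for SOME `u : ℕ → ℤ/2` and every `k < J`,
  `inv_q(S^{J−1−k}[φ] ∪_P [ψ]) = Σ_{j≤k} u_j · ι C_{k−j}(φ(t₀), ψ(Fr))` for every `φ` and every `ψ` vanishing
  on inertia.  Proof: `X(v)` := the transverse class with value `Nv` at `t₀`, `Y(w)` := the unramified class
  with value `w` at `Fr` (file 1); `[φ] − X(v)` vanishes at `t₀`, hence is unramified, and `ur ∪ ur = 0`
  (`TwoLagrangianLines.cupProduct_eq_zero_of_mem_unramifiedSubgroup`); `Φ_k(v, w) = inv_q(S^{J−1−k} X(v) ∪ Y(w))`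
  is shift-compatible and its diagonal values factor through `E[2]/ℓ × E[2]/ℓ ≅ 𝔽₂²`, where `ι e(N·, ·)`
  is THE non-zero form — so koly's `family_eq_weightedConv` applies.  Unit property + adapter: file 3.

References: B. Mazur, K. Rubin, Mem. AMS 799 (2004) §1.2, Prop. 1.3.2 [MazurRubin2004]; K. Rubin, *Euler
Systems* (2000) Lemma 1.4.7, Thm. 4.5.4 [Rubin2000]; J. S. Milne, *ADT* (2006) I Cor. 2.3, Thm. 2.6
[MilneADT2006]; B. Howard, Compositio 140 (2004) Prop. 3.2.4 [Howard2004HeegnerKolyvagin].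
-/
set_option autoImplicit false
set_option linter.dupNamespace false

noncomputable section

open scoped Classical ContRepresentation
open CategoryTheory ContinuousCohomology Function Field ValuativeRel NumberField IsDedekindDomain Finset
open WeierstrassCurve
open Literature.NumberTheory.GaloisRepresentations
open Literature.NumberTheory.GaloisRepresentations.IsNonarchimedeanLocalField
open _root_.TopRep
open Literature.NumberTheory.GaloisCohomology
open Literature.NumberTheory.EllipticCurves
open Summit.BirchSwinnertonDyer.Rank1Residual.GaloisImage
open Summit.BirchSwinnertonDyer.Rank1Residual (X11b.LocBridge.mem_unramifiedSubgroup_one_iff_forall_eq_zero)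
open Summit.BirchSwinnertonDyer.BirchSwinnertonDyer.Rank1Residual
open Summit.BirchSwinnertonDyer.BirchSwinnertonDyer.Rank1Residual.LocalSplitPrime

universe u

namespace Summit.BirchSwinnertonDyer.BirchSwinnertonDyer.Theorems.SteinbergFibreAtTwo

section Transposition

variable (W : WeierstrassCurve ℚ) [W.IsElliptic] (κ : ZpExtension ℚ 2) (J : ℕ)
  (eW : geomTorsion W (2 : ℤ) → geomTorsion W (2 : ℤ) → AlgebraicClosure ℚ)
  (hμ : ∀ S T, eW S T ^ 2 = 1) (hadd₁ : ∀ S₁ S₂ T, eW (S₁ + S₂) T = eW S₁ T * eW S₂ T)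
  (hadd₂ : ∀ S T₁ T₂, eW S (T₁ + T₂) = eW S T₁ * eW S T₂)
  (q : HeightOneSpectrum (𝓞 ℚ)) [Fact (Ideal.absNorm q.asIdeal).Prime]
  [NeZero ((Ideal.absNorm q.asIdeal : ℕ) : q.adicCompletion ℚ)]
  -- cup products on `Γ_{ℚ_q}` need `LocallyCompactSpace` (a `Prop`): an instance binder, as in the odd files
  [LocallyCompactSpace (absoluteGaloisGroup (q.adicCompletion ℚ))]

-- local notation: `E[2]`, the twist `𝒯_J(E, κ)` (= `W.modPTwist 2 κ J` by `rfl`) and the dual twist `𝒯_J(E, κ⁻¹)`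
local notation3 "𝓔" => geomTorsion W (2 : ℤ)
local notation3 "𝓣" => ZpExtension.twistModP κ (WeierstrassCurve.torsionGaloisModule W (2 : ℤ))
  (fun P : geomTorsion W (2 : ℤ) => AddSubgroup.torsionBy.nsmul P) J
local notation3 "𝓓" => ZpExtension.twistModP (ZpExtension.invTwist κ) (WeierstrassCurve.torsionGaloisModule W (2 : ℤ))
  (fun P : geomTorsion W (2 : ℤ) => AddSubgroup.torsionBy.nsmul P) J

set_option maxHeartbeats 800000 in
/-- **The local cup product in VALUE coordinates at a transposition prime is `u(T)·⟨N·, ·⟩_{A_J}` for SOME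
`u`** (`p = 2`, `E/ℚ`; `q ∤ 2`, `E[2]` unramified, `2 ∣ N(q) − 1`, `χ̄_ℓ` onto on inertia, `ρ̄₂(res Fr)` a
TRANSPOSITION, `res Fr ∈ Γ_m`, `J ≤ 2^m`, `t₀` a tame generator; `P` any local pairing whose bilinear map is
the Gorenstein pairing of the Weil pairing hom, `S` acting as the shift): for every `k < J`, EVERY `φ` and
every `ψ` vanishing on inertia, `inv_q(S^{J−1−k}[φ] ∪_P [ψ]) = Σ_{j≤k} u_j · ι C_{k−j}(φ(t₀), ψ(Fr))`.
[cite: MazurRubin2004, Prop. 1.3.2 (p. 12)] [cite: Rubin2000, Thm. 4.5.4] [cite: Howard2004HeegnerKolyvagin, Prop. 3.2.4] -/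
theorem exists_inv_cupProduct_eq_sum_convCoeff_transposition
    (halt : ∀ T, eW T T = 1) (hnondeg : ∀ T, (∀ S, eW S T = 1) → T = 0)
    (ι : DiscreteGaloisModule.MuCarrier ℚ 2 →+ ZMod 2) (hι : Function.Injective ι)
    (hunr : GaloisRep.IsUnramifiedAt q (W.torsionGaloisModule (2 : ℤ)))
    (hqp : ((2 : ℕ) : 𝓞 ℚ) ∉ q.asIdeal) (hpl : 2 ∣ Ideal.absNorm q.asIdeal - 1)
    (hχI : ∀ u : (ZMod (Ideal.absNorm q.asIdeal))ˣ, ∃ t ∈ absInertia (q.adicCompletion ℚ),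
      modPCyclotomicCharacterZMod (q.adicCompletion ℚ) (Ideal.absNorm q.asIdeal) t = u)
    {Fr : absoluteGaloisGroup (q.adicCompletion ℚ)} (hFr : IsAbsArithFrob Fr)
    (hT1 : galoisRepTorsion W 2 (absGaloisRestrict ℚ (q.adicCompletion ℚ) Fr) ≠ 1)
    (hT2 : galoisRepTorsion W 2
      (absGaloisRestrict ℚ (q.adicCompletion ℚ) Fr * absGaloisRestrict ℚ (q.adicCompletion ℚ) Fr) = 1)
    {m : ℕ} (hJm : J ≤ 2 ^ m) (hFrm : absGaloisRestrict ℚ (q.adicCompletion ℚ) Fr ∈ κ.layerSubgroup m)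
    {t₀ : absoluteGaloisGroup (q.adicCompletion ℚ)} (ht₀ : t₀ ∈ absInertia (q.adicCompletion ℚ))
    (hgen : ∀ u : (ZMod (Ideal.absNorm q.asIdeal))ˣ,
      u ∈ Subgroup.zpowers (modPCyclotomicCharacterZMod (q.adicCompletion ℚ) (Ideal.absNorm q.asIdeal) t₀))
    (inv : LocalInvariants ℚ 2)
    (P : ContPairing (GaloisRep.toLocal q 𝓣).toTopRep (GaloisRep.toLocal q 𝓓).toTopRep
      ((DiscreteGaloisModule.mu ℚ 2).toLocal (Sum.inr q)).toTopRep)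
    (hP : ∀ x y, P.toLin x y = gorensteinPairing (weilPairingHom W 2 eW hμ hadd₁ hadd₂) J x y)
    (S : (GaloisRep.toLocal q 𝓣).toContRepresentation →ⁱL (GaloisRep.toLocal q 𝓣).toContRepresentation)
    (hS : ∀ x, S x = shiftEnd 𝓔 J x) :
    ∃ u : ℕ → ZMod 2,
      ∀ k < J, ∀ (φ : contOneCocycles (GaloisRep.toLocal q 𝓣).toTopRep)
        (ψ : contOneCocycles (GaloisRep.toLocal q 𝓓).toTopRep),
        (∀ t ∈ absInertia (q.adicCompletion ℚ), ψ.1 t = 0) →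
        inv (Sum.inr q) (P.cupProduct
            ((galoisCohomology.map S 1)^[J - 1 - k] (oneCocycleClass _ φ)) (oneCocycleClass _ ψ)) =
          ∑ j ∈ Finset.range (k + 1), u j *
            ι (convCoeff (weilPairingHom W 2 eW hμ hadd₁ hadd₂) J (k - j) (φ.1 t₀) (ψ.1 Fr)) := by
  classical
  rcases Nat.eq_zero_or_pos J with hJ0 | hJ
  · exact ⟨fun _ => 1, fun k hk => absurd hk (by omega)⟩
  haveI : Finite 𝓔 := finite_geomTorsion_of_neZero W 2
  haveI : Finite (DiscreteGaloisModule.MuCarrier ℚ 2) :=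
    Literature.NumberTheory.GaloisRepresentations.finite_muCarrier ℚ 2
  -- local facts at `q`
  have hI : ∀ t ∈ absInertia (q.adicCompletion ℚ), ∀ x : Fin J → 𝓔, GaloisRep.toLocal q 𝓣 t x = x :=
    fun _ ht x => toLocal_twistModP_apply_of_mem_absInertia (W.torsionGaloisModule (2 : ℤ))
      (fun P : 𝓔 => AddSubgroup.torsionBy.nsmul P) κ J q hunr hqp ht x
  have hI' : ∀ t ∈ absInertia (q.adicCompletion ℚ), ∀ y : Fin J → 𝓔, GaloisRep.toLocal q 𝓓 t y = y :=
    fun _ ht y => toLocal_twistModP_apply_of_mem_absInertia (W.torsionGaloisModule (2 : ℤ))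
      (fun P : 𝓔 => AddSubgroup.torsionBy.nsmul P) κ.invTwist J q hunr hqp ht y
  have hI'1 : ∀ t ∈ absInertia (q.adicCompletion ℚ), GaloisRep.toLocal q 𝓓 t = 1 :=
    fun t ht => LinearMap.ext (hI' t ht)
  have hℓM : ∀ x : Fin J → 𝓔, (Ideal.absNorm q.asIdeal - 1) • x = 0 :=
    sub_one_smul_eq_zero_of_dvd (fun P : 𝓔 => AddSubgroup.torsionBy.nsmul P) hpl
  have hFrm' : absGaloisRestrict ℚ (q.adicCompletion ℚ) Fr ∈ κ.invTwist.layerSubgroup m := by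
    rw [ZpExtension.layerSubgroup_invTwist]; exact hFrm
  have hFrT' : ∀ y : Fin J → 𝓔,
      GaloisRep.toLocal q 𝓓 Fr y = fun i => absGaloisRestrict ℚ (q.adicCompletion ℚ) Fr • y i :=
    fun y => toLocal_twistModP_apply_of_mem_layerSubgroup_of_le (W.torsionGaloisModule (2 : ℤ))
      (fun P : 𝓔 => AddSubgroup.torsionBy.nsmul P) κ.invTwist J q hJm hFrm' y
  -- ### `E[2]` under the transposition `g = res Fr`: `N = g − 1`, `ker N = im N = {0, P₀}`
  obtain ⟨P₀, hP₀, hker, him⟩ := exists_fixedPoint_of_transposition W hT1 hT2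
  obtain ⟨Q, hQ⟩ : ∃ Q : geomTorsion W 2, absGaloisRestrict ℚ (q.adicCompletion ℚ) Fr • Q ≠ Q := by
    by_contra h; push Not at h; exact hT1 ((mem_ker_galoisRepTorsion_two_iff W _).2 h)
  obtain ⟨Ng, hNg⟩ : ∃ N : 𝓔 →+ 𝓔, ∀ a, N a = absGaloisRestrict ℚ (q.adicCompletion ℚ) Fr • a - a :=
    ⟨AddMonoidHom.mk' (fun a => absGaloisRestrict ℚ (q.adicCompletion ℚ) Fr • a - a)
      (fun a b => by rw [smul_add]; abel), fun _ => rfl⟩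
  have hNg0 : ∀ a, Ng a = 0 ↔ absGaloisRestrict ℚ (q.adicCompletion ℚ) Fr • a = a := fun a => by
    rw [hNg, sub_eq_zero]
  have hNgP : ∀ a, absGaloisRestrict ℚ (q.adicCompletion ℚ) Fr • a ≠ a → Ng a = P₀ := fun a ha => by
    rw [hNg]; exact him a ha
  have hkerN : ∀ a, absGaloisRestrict ℚ (q.adicCompletion ℚ) Fr • a = a → ∃ b, a = Ng b := fun a ha => by
    rcases (hker a).1 ha with rfl | rfl
    · exact ⟨0, (map_zero Ng).symm⟩
    · exact ⟨Q, (hNgP Q hQ).symm⟩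
  have hNvec : ∀ c : Fin J → 𝓔, (fun i => Ng (c i)) = GaloisRep.toLocal q 𝓓 Fr c - c := fun c => by
    rw [hFrT' c]; funext i; simp only [Pi.sub_apply, hNg]
  have hPiN : ∀ (c : 𝓔) (h0 : 0 < J),
      (fun j => Ng ((Pi.single (⟨0, h0⟩ : Fin J) c : Fin J → 𝓔) j)) = Pi.single (⟨0, h0⟩ : Fin J) (Ng c) := by
    intro c h0; funext j; by_cases hj : j = ⟨0, h0⟩
    · subst hj; rw [Pi.single_eq_same, Pi.single_eq_same]
    · rw [Pi.single_eq_of_ne hj, Pi.single_eq_of_ne hj, map_zero]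
  have hN0 : (fun i : Fin J => Ng ((0 : Fin J → 𝓔) i)) = 0 := by
    funext i; simp only [Pi.zero_apply, map_zero]
  -- the value parametrisations (file 1): (X) transverse with value `N ∘ v` at `t₀`, (Y) unramified with value at `Fr`
  have hXex : ∀ v : Fin J → 𝓔, ∃ φ : contOneCocycles (GaloisRep.toLocal q 𝓣).toTopRep,
      oneCocycleClass _ φ ∈ DiscreteGaloisModule.transverseSubgroup (GaloisRep.toLocal q 𝓣)
        (CyclotomicField (Ideal.absNorm q.asIdeal) (q.adicCompletion ℚ)) ∧
      φ.1 t₀ = fun i => Ng (v i) := fun v => by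
    obtain ⟨φ, h1, h2⟩ := exists_transverse_cocycle_apply_eq_smul_sub_two W κ J q hunr hqp hpl hχI hFr hT1
      hT2 hJm hFrm ht₀ hgen v
    exact ⟨φ, h1, by rw [h2]; funext i; rw [hNg]⟩
  choose φt hφt_tr hφt_val using hXex
  choose ψf hψf_ur hψf_val using exists_unramified_cocycle_apply_frob_eq (GaloisRep.toLocal q 𝓓) hI'1 hFr
  -- uniqueness of classes with given values
  have hXeq : ∀ (v : Fin J → 𝓔) (φ : contOneCocycles (GaloisRep.toLocal q 𝓣).toTopRep),
      oneCocycleClass _ φ ∈ DiscreteGaloisModule.transverseSubgroup (GaloisRep.toLocal q 𝓣)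
        (CyclotomicField (Ideal.absNorm q.asIdeal) (q.adicCompletion ℚ)) →
      (φ.1 t₀ = fun i => Ng (v i)) → oneCocycleClass _ φ = oneCocycleClass _ (φt v) :=
    fun v φ hφ hv => oneCocycleClass_eq_of_transverse_of_apply_eq (W.torsionGaloisModule (2 : ℤ))
      (fun P : 𝓔 => AddSubgroup.torsionBy.nsmul P) κ J q hunr hqp hpl hχI ht₀ hgen
      φ (φt v) hφ (hφt_tr v) (by rw [hv, hφt_val])
  have hYeq : ∀ (f : Fin J → 𝓔) (ψ : contOneCocycles (GaloisRep.toLocal q 𝓓).toTopRep),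
      (∀ t ∈ absInertia (q.adicCompletion ℚ), ψ.1 t = 0) →
      (∃ c : Fin J → 𝓔, ψ.1 Fr - f = fun i => Ng (c i)) →
      oneCocycleClass _ ψ = oneCocycleClass _ (ψf f) := by
    rintro f ψ hψ ⟨c, hc⟩
    exact oneCocycleClass_eq_of_unramified_of_apply_frob_sub_mem _ hI'1 hFr ψ (ψf f) hψ (hψf_ur f) (m := c)
      (by rw [hψf_val, hc]; exact hNvec c)
  -- ### the class maps `X`, `Y`
  obtain ⟨X, hX⟩ : ∃ X : (Fin J → 𝓔) → galoisCohomology (GaloisRep.toLocal q 𝓣) 1,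
      ∀ v, X v = oneCocycleClass _ (φt v) := ⟨_, fun _ => rfl⟩
  obtain ⟨Y, hY⟩ : ∃ Y : (Fin J → 𝓔) → galoisCohomology (GaloisRep.toLocal q 𝓓) 1,
      ∀ f, Y f = oneCocycleClass _ (ψf f) := ⟨_, fun _ => rfl⟩
  have hXcongr : ∀ v v' : Fin J → 𝓔, (∀ i, Ng (v i) = Ng (v' i)) → X v = X v' := by
    intro v v' h; rw [hX, hX]
    exact hXeq v' (φt v) (hφt_tr v) (by rw [hφt_val]; funext i; exact h i)
  have hXadd : ∀ v v', X (v + v') = X v + X v' := by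
    intro v v'
    have htr : oneCocycleClass _ (φt v + φt v') ∈ DiscreteGaloisModule.transverseSubgroup
        (GaloisRep.toLocal q 𝓣) (CyclotomicField (Ideal.absNorm q.asIdeal) (q.adicCompletion ℚ)) := by
      rw [oneCocycleClass_add]; exact AddSubgroup.add_mem _ (hφt_tr v) (hφt_tr v')
    have h := hXeq (v + v') (φt v + φt v') htr (by
      rw [Submodule.coe_add, ContinuousMap.add_apply, hφt_val, hφt_val]
      funext i
      simp only [Pi.add_apply, map_add])
    rw [hX, hX, hX]
    exact h.symm.trans (oneCocycleClass_add _ _ _)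
  have hX0 : X 0 = 0 := by simpa using hXadd 0 0
  have hYcongr : ∀ f f' : Fin J → 𝓔, (∃ c : Fin J → 𝓔, f - f' = fun i => Ng (c i)) → Y f = Y f' := by
    rintro f f' ⟨c, hc⟩
    rw [hY, hY]
    exact hYeq f' (ψf f) (hψf_ur f) ⟨c, by rw [hψf_val]; exact hc⟩
  have hYadd : ∀ f f', Y (f + f') = Y f + Y f' := by
    intro f f'
    have h := hYeq (f + f') (ψf f + ψf f')
      (fun t ht => by
        rw [Submodule.coe_add, ContinuousMap.add_apply, hψf_ur f t ht, hψf_ur f' t ht, add_zero])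
      ⟨0, by
        rw [Submodule.coe_add, ContinuousMap.add_apply, hψf_val, hψf_val, sub_self]
        exact hN0.symm⟩
    rw [hY, hY, hY]
    exact h.symm.trans (oneCocycleClass_add _ _ _)
  have hY0 : Y 0 = 0 := by simpa using hYadd 0 0
  have hY0' : ∀ f : Fin J → 𝓔, (∃ c : Fin J → 𝓔, f = fun i => Ng (c i)) → Y f = 0 := by
    rintro f ⟨c, hc⟩
    exact (hYcongr f 0 ⟨c, by rw [sub_zero]; exact hc⟩).trans hY0
  -- opaque abbreviations `mS = H¹(S)`, `cup a b = inv_q(a ∪_P b)`; `ur ∪ ur = 0`; the shifts on classes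
  obtain ⟨mS, hmS⟩ : ∃ mS : galoisCohomology (GaloisRep.toLocal q 𝓣) 1 →+ galoisCohomology (GaloisRep.toLocal q 𝓣) 1,
      mS = galoisCohomology.map S 1 := ⟨_, rfl⟩
  obtain ⟨cup, hcup⟩ : ∃ cup : galoisCohomology (GaloisRep.toLocal q 𝓣) 1 →
      galoisCohomology (GaloisRep.toLocal q 𝓓) 1 → ZMod 2,
      ∀ a b, cup a b = inv (Sum.inr q) (P.cupProduct a b) := ⟨_, fun _ _ => rfl⟩
  have hcup_add_left : ∀ a a' b, cup (a + a') b = cup a b + cup a' b := fun a a' b => by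
    rw [hcup, hcup, hcup]; exact (congrArg (inv (Sum.inr q)) (LinearMap.congr_fun (map_add P.cupProduct a a') b)).trans
      (map_add (inv (Sum.inr q)) _ _)
  have hcup_add_right : ∀ a b b', cup a (b + b') = cup a b + cup a b' := fun a b b' => by
    rw [hcup, hcup, hcup]
    exact (congrArg (inv (Sum.inr q)) (map_add (P.cupProduct a) b b')).trans (map_add (inv (Sum.inr q)) _ _)
  have hcup_zero_left : ∀ b, cup 0 b = 0 := fun b => by simpa using hcup_add_left 0 0 b
  have hcup_zero_right : ∀ a, cup a 0 = 0 := fun a => by simpa using hcup_add_right a 0 0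
  have hcup_ur : ∀ a b, a ∈ DiscreteGaloisModule.unramifiedSubgroup (GaloisRep.toLocal q 𝓣) 1 →
      b ∈ DiscreteGaloisModule.unramifiedSubgroup (GaloisRep.toLocal q 𝓓) 1 → cup a b = 0 := by
    intro a b ha hb
    rw [hcup]
    exact (congrArg (inv (Sum.inr q))
      (TwoLagrangianLines.cupProduct_eq_zero_of_mem_unramifiedSubgroup P ha hb)).trans (map_zero _)
  have hSit : ∀ (i : ℕ) (v : Fin J → 𝓔), (fun x => S x)^[i] v = (shiftEnd 𝓔 J ^ i) v := by
    intro i v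
    induction i with
    | zero => simp
    | succ i ih => rw [Function.iterate_succ_apply', ih, hS, pow_succ', Module.End.mul_apply]
  have hXshift : ∀ (i : ℕ) (v : Fin J → 𝓔), (⇑mS)^[i] (X v) = X ((shiftEnd 𝓔 J ^ i) v) := by
    intro i v
    obtain ⟨φ', h1, h2⟩ := map_iterate_oneCocycleClass _ S i (φt v)
    rw [hmS, hX, hX, h2]
    refine hXeq _ φ' ?_ ?_
    · rw [← h2]; exact iterate_map_mem_transverseSubgroup _ _ S i (hφt_tr v)
    · rw [h1, hSit, hφt_val]
      exact shiftEnd_pow_comp_apply Ng i v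
  have hXshift1 : ∀ v : Fin J → 𝓔, mS (X v) = X (shiftEnd 𝓔 J v) := fun v => by
    simpa only [Function.iterate_one, pow_one] using hXshift 1 v
  have hmSur : ∀ (n : ℕ) (a : galoisCohomology (GaloisRep.toLocal q 𝓣) 1),
      a ∈ DiscreteGaloisModule.unramifiedSubgroup (GaloisRep.toLocal q 𝓣) 1 →
      (⇑mS)^[n] a ∈ DiscreteGaloisModule.unramifiedSubgroup (GaloisRep.toLocal q 𝓣) 1 := by
    intro n a ha
    induction n with
    | zero => exact ha
    | succ n ih =>
      rw [Function.iterate_succ_apply', hmS]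
      exact map_mem_unramifiedSubgroup' _ _ S (by rw [← hmS]; exact ih)
  obtain ⟨S', hS'⟩ := exists_contIntertwiningMap_of_comm (GaloisRep.toLocal q 𝓓) (GaloisRep.toLocal q 𝓓)
    (shiftEnd 𝓔 J).toAddMonoidHom
    (fun g y => ZpExtension.shiftEnd_twistModP_apply κ.invTwist (W.torsionGaloisModule (2 : ℤ))
      (fun P : 𝓔 => AddSubgroup.torsionBy.nsmul P) J _ y)
  have hYshift : ∀ f : Fin J → 𝓔, galoisCohomology.map S' 1 (Y f) = Y (shiftEnd 𝓔 J f) := by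
    intro f
    obtain ⟨ψ', h1, h2⟩ := galoisCohomology_map_oneCocycleClass _ _ S' (ψf f)
    rw [hY, hY, h2]
    refine hYeq _ ψ' ?_ ⟨0, ?_⟩
    · intro t ht; rw [h1, hψf_ur f t ht, map_zero]
    · rw [h1, hψf_val, hS', LinearMap.toAddMonoidHom_coe, sub_self]
      exact hN0.symm
  have hcupS : ∀ a b, cup (mS a) b = cup a (galoisCohomology.map S' 1 b) := by
    intro a b
    rw [hcup, hcup, hmS]
    exact congrArg (inv (Sum.inr q)) (ContPairing.cupProduct_adjoint P P
      (TopRep.ofHom ⟨S.toContinuousLinearMap, S.isIntertwining'⟩)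
      (TopRep.ofHom ⟨S'.toContinuousLinearMap, S'.isIntertwining'⟩)
      (fun x y => by
        change P.toLin (S x) y = P.toLin x (S' y)
        rw [hP, hP, hS, hS']
        exact gorensteinPairing_shiftEnd_comm (weilPairingHom W 2 eW hμ hadd₁ hadd₂) x y) a b)
  -- the coefficient family `Φ_k(v, f) = inv_q(T^{J−1−k} X(v) ∪ Y(f))`, shift-compatible
  obtain ⟨Φf, hΦf⟩ : ∃ Φf : ℕ → (Fin J → 𝓔) → (Fin J → 𝓔) → ZMod 2,
      ∀ k v f, Φf k v f = cup ((⇑mS)^[J - 1 - k] (X v)) (Y f) := ⟨_, fun _ _ _ => rfl⟩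
  have hΦf_add_right : ∀ k v f f', Φf k v (f + f') = Φf k v f + Φf k v f' := by
    intro k v f f'
    rw [hΦf, hΦf, hΦf, hYadd, hcup_add_right]
  have hΦf_add_left : ∀ k v v' f, Φf k (v + v') f = Φf k v f + Φf k v' f := by
    intro k v v' f
    rw [hΦf, hΦf, hΦf, hXadd, iterate_map_add', hcup_add_left]
  obtain ⟨Φ, hΦ⟩ : ∃ Φ : ℕ → (Fin J → 𝓔) →+ (Fin J → 𝓔) →+ ZMod 2,
      ∀ (k : ℕ) (v f : Fin J → 𝓔), Φ k v f = cup ((⇑mS)^[J - 1 - k] (X v)) (Y f) :=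
    ⟨fun k => AddMonoidHom.mk' (fun v => AddMonoidHom.mk' (fun f => Φf k v f) (hΦf_add_right k v))
      (fun v v' => AddMonoidHom.ext fun f => hΦf_add_left k v v' f), fun k v f => hΦf k v f⟩
  have hXzero : ∀ (a : ℕ) (x : Fin J → 𝓔), J ≤ a → X ((shiftEnd 𝓔 J ^ a) x) = 0 := by
    intro a x ha
    rw [shiftEnd_pow_apply_eq_zero_of_le ha x, hX0]
  have hLs : ∀ (k : ℕ) (x y : Fin J → 𝓔), k + 1 < J → Φ (k + 1) (shiftEnd 𝓔 J x) y = Φ k x y := by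
    intro k x y hk
    obtain ⟨n, hn1, hn2⟩ : ∃ n, J - 1 - (k + 1) = n ∧ J - 1 - k = n + 1 := ⟨J - 1 - (k + 1), rfl, by omega⟩
    rw [hΦ, hΦ, hn1, hn2, Function.iterate_succ_apply (⇑mS) n (X x), hXshift1 x]
  have hL0 : ∀ (x y : Fin J → 𝓔), Φ 0 (shiftEnd 𝓔 J x) y = 0 := by
    intro x y
    rw [hΦ, hXshift, shiftEnd_pow_shiftEnd_apply, hXzero _ x (by omega), hcup_zero_left]
  have hRs : ∀ (k : ℕ) (x y : Fin J → 𝓔), k + 1 < J → Φ (k + 1) x (shiftEnd 𝓔 J y) = Φ k x y := by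
    intro k x y hk
    obtain ⟨n, hn1, hn2⟩ : ∃ n, J - 1 - (k + 1) = n ∧ J - 1 - k = n + 1 := ⟨J - 1 - (k + 1), rfl, by omega⟩
    rw [hΦ, hΦ, hn1, hn2, Function.iterate_succ_apply' (⇑mS) n (X x), hcupS, hYshift y]
  have hR0 : ∀ (x y : Fin J → 𝓔), Φ 0 x (shiftEnd 𝓔 J y) = 0 := by
    intro x y
    rw [hΦ, ← hYshift y, ← hcupS, hXshift, hXshift1, shiftEnd_shiftEnd_pow_apply,
      hXzero _ x (by omega), hcup_zero_left]
  -- values on constant vectors: the diagonal factors through `E[2]/ℓ × E[2]/ℓ ≅ 𝔽₂²`; `e'(a, b) = ι e(N a, b)`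
  obtain ⟨e', he'⟩ : ∃ e' : 𝓔 →+ 𝓔 →+ ZMod 2, ∀ a b, e' a b = ι (weilPairingHom W 2 eW hμ hadd₁ hadd₂ (Ng a) b) :=
    ⟨AddMonoidHom.mk' (fun a => ι.comp (weilPairingHom W 2 eW hμ hadd₁ hadd₂ (Ng a)))
      (fun a a' => AddMonoidHom.ext fun b => by
        simp only [AddMonoidHom.comp_apply, map_add, AddMonoidHom.add_apply]), fun _ _ => rfl⟩
  have heP₀ : ∀ b : 𝓔, weilPairingHom W 2 eW hμ hadd₁ hadd₂ P₀ b = 0 ↔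
      absGaloisRestrict ℚ (q.adicCompletion ℚ) Fr • b = b :=
    weilPairingHom_eq_zero_iff_smul_eq_of_transposition W eW hμ hadd₁ hadd₂ halt hnondeg hP₀ hker him
  set u : ℕ → ZMod 2 := fun k => Φ k (Pi.single (⟨0, hJ⟩ : Fin J) Q) (Pi.single (⟨0, hJ⟩ : Fin J) Q) with hu
  have hδ : ∀ k < J, ∀ (a b : 𝓔) (h0 : 0 < J),
      Φ k (Pi.single (⟨0, h0⟩ : Fin J) a) (Pi.single (⟨0, h0⟩ : Fin J) b) = u k * e' a b := by
    intro k hk a b h0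
    by_cases ha : absGaloisRestrict ℚ (q.adicCompletion ℚ) Fr • a = a
    · -- `N a = 0`: `X(δ a) = 0`
      have hXa : X (Pi.single (⟨0, h0⟩ : Fin J) a) = 0 := by
        rw [← hX0]
        refine hXcongr _ _ fun i => ?_
        by_cases hi : i = ⟨0, h0⟩
        · subst hi; rw [Pi.single_eq_same, Pi.zero_apply, map_zero]; exact (hNg0 a).2 ha
        · rw [Pi.single_eq_of_ne hi, Pi.zero_apply]
      rw [hΦ, hXa, iterate_map_zero', hcup_zero_left, he', (hNg0 a).2 ha, map_zero, AddMonoidHom.zero_apply,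
        map_zero, mul_zero]
    · by_cases hb : absGaloisRestrict ℚ (q.adicCompletion ℚ) Fr • b = b
      · -- `b ∈ ker N = im N`: `Y(δ b) = 0` and `e(P₀, b) = 0`
        obtain ⟨c, hc⟩ := hkerN b hb
        have hYb : Y (Pi.single (⟨0, h0⟩ : Fin J) b) = 0 :=
          hY0' _ ⟨Pi.single (⟨0, h0⟩ : Fin J) c, by rw [hc]; exact (hPiN c h0).symm⟩
        rw [hΦ, hYb, hcup_zero_right, he', hNgP a ha, (heP₀ b).2 hb, map_zero, mul_zero]
      · -- both moved: reduce to `(Q, Q)`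
        have hXa : X (Pi.single (⟨0, h0⟩ : Fin J) a) = X (Pi.single (⟨0, h0⟩ : Fin J) Q) :=
          hXcongr _ _ fun i => by
            by_cases hi : i = ⟨0, h0⟩
            · subst hi; rw [Pi.single_eq_same, Pi.single_eq_same, hNgP a ha, hNgP Q hQ]
            · rw [Pi.single_eq_of_ne hi, Pi.single_eq_of_ne hi]
        have hbQ : absGaloisRestrict ℚ (q.adicCompletion ℚ) Fr • (b - Q) = b - Q := by
          rw [smul_sub, sub_eq_sub_iff_sub_eq_sub, him b hb, him Q hQ]
        obtain ⟨c, hc⟩ := hkerN _ hbQ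
        have hYb : Y (Pi.single (⟨0, h0⟩ : Fin J) b) = Y (Pi.single (⟨0, h0⟩ : Fin J) Q) :=
          hYcongr _ _ ⟨Pi.single (⟨0, h0⟩ : Fin J) c, by rw [← Pi.single_sub, hc]; exact (hPiN c h0).symm⟩
        have hne : weilPairingHom W 2 eW hμ hadd₁ hadd₂ (Ng a) b ≠ 0 := by
          rw [hNgP a ha]; exact fun h => hb ((heP₀ b).1 h)
        have hval : ι (weilPairingHom W 2 eW hμ hadd₁ hadd₂ (Ng a) b) = 1 :=
          zmod_two_eq_one_of_ne_zero _ fun h => hne ((injective_iff_map_eq_zero ι).1 hι _ h)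
        rw [hΦ, hXa, hYb, ← hΦ, he', hval, mul_one]
  have hfam : ∀ k < J, ∀ (x y : Fin J → 𝓔),
      Φ k x y = ∑ j ∈ Finset.range (k + 1), u j * convCoeff e' J (k - j) x y :=
    fun k hk x y => family_eq_weightedConv e' u Φ hL0 hLs hR0 hRs hδ hk x y
  have hconv : ∀ (i : ℕ) (x y : Fin J → 𝓔),
      convCoeff e' J i x y = ι (convCoeff (weilPairingHom W 2 eW hμ hadd₁ hadd₂) J i (fun j => Ng (x j)) y) := by
    intro i x y
    rw [convCoeff_def, convCoeff_def, map_sum]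
    refine Finset.sum_congr rfl fun a _ => ?_
    rw [he', coeffFun_map]
  -- the IDENTITY for arbitrary `φ` and unramified `ψ`: `[φ] − X(v)` vanishes at `t₀`, hence is unramified
  refine ⟨u, fun k hk φ ψ hψ => ?_⟩
  obtain ⟨v, hv⟩ := exists_cocycle_apply_eq_smul_sub_two W κ J q hunr hqp hpl hχI hT1 hT2 hJm hFrm φ ht₀
  have hv' : φ.1 t₀ = fun i => Ng (v i) := by rw [hv]; funext i; rw [hNg]
  obtain ⟨cφ, hcφ⟩ : ∃ cφ : galoisCohomology (GaloisRep.toLocal q 𝓣) 1, cφ = oneCocycleClass _ φ := ⟨_, rfl⟩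
  have hur : cφ - X v ∈ DiscreteGaloisModule.unramifiedSubgroup (GaloisRep.toLocal q 𝓣) 1 := by
    have hsub : cφ - X v = oneCocycleClass _ (φ - φt v) := by
      rw [hcφ, hX]; exact (oneCocycleClass_sub _ _ _).symm
    rw [hsub]
    refine mem_unramifiedSubgroup_of_apply_eq_zero _ (Ideal.absNorm q.asIdeal)
      (ringChar_residueField_adicCompletion_eq q) hI hℓM hχI ht₀ hgen
      (φ - φt v) ?_
    rw [Submodule.coe_sub, ContinuousMap.sub_apply, hv', hφt_val, sub_self]
  have hψY : oneCocycleClass _ ψ = Y (ψ.1 Fr) := by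
    rw [hY]
    exact hYeq _ ψ hψ ⟨0, by rw [sub_self]; exact hN0.symm⟩
  have hψur : oneCocycleClass _ ψ ∈ DiscreteGaloisModule.unramifiedSubgroup (GaloisRep.toLocal q 𝓓) 1 :=
    (X11b.LocBridge.mem_unramifiedSubgroup_one_iff_forall_eq_zero _ hI' ψ).2 hψ
  have hsplit : cφ = X v + (cφ - X v) := by abel
  rw [← hmS, ← hcup, ← hcφ, hsplit, iterate_map_add', hcup_add_left, hcup_ur _ _ (hmSur _ _ hur) hψur, add_zero,
    hψY, ← hΦ, hfam k hk, hv']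
  exact Finset.sum_congr rfl fun j _ => by rw [hconv]

end Transposition

end Summit.BirchSwinnertonDyer.BirchSwinnertonDyer.Theorems.SteinbergFibreAtTwo

end
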